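import Summits.Parity.GeneralizedHardyLittlewood.Theorems.PrimeLevelFamEdgeMomentsBeyondDiagonalDiagRemP2Hyperbola
import Summits.Parity.GeneralizedHardyLittlewood.Theorems.BeyondDiagonalBeatsQuarter.CornerMoebius
import Summits.Parity.GeneralizedHardyLittlewood.Theorems.BeyondDiagonalBeatsQuarter.KernelFormXSqBridge
import HarnessLib

/-!
# Route `PrimeLevelFamEdge`, crux K_A `MomentsBeyondDiagonal` (stmt-Parity-20007), line «petersson_layers» v4, stub `stub_diag`:
# **the Dirichlet rearrangement of the `P₂`-decorated Selberg coefficients** (L5a of the (P2TAIL) chain):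
# `Σ_{k ≤ N} a_n(k)P₂(k) = Σ_{m ≤ N} h_n(m)·(2N(N/m) + P̃₂(m)·MM(N/m))`

Combinatorial half of the last link of the ONE new analytic input of the order-`(2,2)` remainder estimate of `stub_diag`
(plan `Cruxes/MomentsBeyondDiagonal/Lines/petersson_layers_stub_diag_g12_R02_R22.md`): with `a_n = copTauW n = (G∗G)∗h_n`
(`…KernelFormXSq.copTauW_eq_G_mul_G_mul_hloc`, `G = μ/id`) and the COMPLETELY additive `P̃₂(m) = Σ_p v_p(m)log²p` (`= P₂` on
squarefree numbers, where `a_n` and `μ` live),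
`a_n·P₂ = 2((GP₂)∗G)∗h_n + (G∗G)∗(h_nP̃₂)`, so `Σ_{k≤y} a_n(k)P₂(k) = Σ_{m≤y} h_n(m)(2N(y/m) + P̃₂(m)MM(y/m))` with
`N(z) = Σ_{de≤z} μ(d)P₂(d)μ(e)/(de) = −1 + O((1+log z)⁻ⁿ)` (`…DiagRemP2Hyperbola`) and `MM(z) = Σ_{de≤z}μ(d)μ(e)/(de) = O((1+log z)⁻¹²)`
(`…Corner.abs_moebiusSqSum_le`); the tails are those of `…Corner.abs_sum_copTauW_le` (`Σ_m|h_n(m)|m^{1/8} ≤ C·D(n)`).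

* `factorization_sum_logSq_mul`, `factorization_sum_logSq_of_squarefree` — `P̃₂` is completely additive and equals `P₂` on
  squarefree numbers;
* `sum_copTauW_primeSq_eq` — **the rearrangement** (exact, every `n`, `N`).

What remains for (P2TAIL) (L5b): insert `N(z) + 1 = O((1+log z)⁻¹²)` (L4), `MM = O((1+log)⁻¹²)`, `P̃₂(m) ≤ log²m ≪ m^{1/16}`, the tree's
`Σ_m |h_n(m)| m^{1/8} ≤ C·D(n)` and `c_n := −2Σ_m h_n(m)`; bookkeeping as in `…Corner.abs_sum_copTauW_le`.

Def-free; theorems only. Helper `--supports stmt-Parity-20007`; closes nothing; K_A, K_B and the Parity summit are NOT proved;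
nothing about Landau–Siegel zeros.

## References
* E. Kowalski, P. Michel, J. VanderKam, J. reine angew. Math. 526 (2000), Prop. 5.1 p. 18.
  [cite: KowalskiMichelVanderKam2000, Prop. 5.1 — derivation (P₂-twisted Selberg coefficients)]
-/

noncomputable section

open Finset Real
open scoped ArithmeticFunction.Moebius

namespace Summit.Parity.GeneralizedHardyLittlewood.Theorems.MomentsBeyondDiagonal.DiagCorner

open Literature.NumberTheory.LFunctions.KMV2000.MollifierMainTerm (G W)
open Summit.Parity.GeneralizedHardyLittlewood.Theorems.BeyondDiagonalBeatsQuarter.KernelFormXSq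
  (copTauW copTauW_apply hloc divWeight divWeight_nonneg copTauW_eq_G_mul_G_mul_hloc tsum_abs_hloc_mul_rpow_le
   summable_abs_hloc_mul_rpow summable_hloc W_eq_zero_of_not_squarefree G_apply')
open Literature.NumberTheory.LFunctions.SiegelWalfiszLiouville (sum_Ioc_sum_divisorsAntidiagonal_eq)
open Literature.Barriers.Parity (Icc_one_eq_Ioc_zero)
open Summit.Parity.GeneralizedHardyLittlewood.Theorems.BeyondDiagonalBeatsQuarter.Corner
  (abs_moebiusSqSum_le inv_log_pow_le_rpow_mul)

/-! ### The completely additive `P̃₂` -/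

/-- `P̃₂(ab) = P̃₂(a) + P̃₂(b)` (`a, b ≥ 1`), `P̃₂(m) = Σ_p v_p(m)·log²p`. [folklore] -/
theorem factorization_sum_logSq_mul {a b : ℕ} (ha : a ≠ 0) (hb : b ≠ 0) :
    ((a * b).factorization.sum fun p k ↦ (k : ℝ) * Real.log p ^ 2) =
      (a.factorization.sum fun p k ↦ (k : ℝ) * Real.log p ^ 2) +
        b.factorization.sum fun p k ↦ (k : ℝ) * Real.log p ^ 2 := by
  rw [Nat.factorization_mul ha hb, Finsupp.sum_add_index']
  · intro p; simp
  · intro p k₁ k₂; push_cast; ring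

/-- On squarefree `m`: `P̃₂(m) = P₂(m) = Σ_{p ∣ m} log²p`. [folklore] -/
theorem factorization_sum_logSq_of_squarefree {m : ℕ} (hm : Squarefree m) :
    (m.factorization.sum fun p k ↦ (k : ℝ) * Real.log p ^ 2) = ∑ p ∈ m.primeFactors, Real.log p ^ 2 := by
  rw [Finsupp.sum, Nat.support_factorization]
  refine Finset.sum_congr rfl fun p hp ↦ ?_
  have h1 : m.factorization p = 1 := by
    have hle := (Nat.squarefree_iff_factorization_le_one hm.ne_zero).1 hm p
    have hpos : 0 < m.factorization p := Nat.Prime.factorization_pos_of_dvd (Nat.prime_of_mem_primeFactors hp)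
      hm.ne_zero (Nat.dvd_of_mem_primeFactors hp)
    omega
  rw [h1]; simp

/-! ### The Dirichlet rearrangement (L5a) -/

/-- **`Σ_{k ≤ N} a_n(k)P₂(k) = Σ_{m ≤ N} h_n(m)·(2·N(N/m) + P̃₂(m)·MM(N/m))`.**
[cite: KowalskiMichelVanderKam2000, Prop. 5.1 — derivation (P₂-twisted coefficients)] -/
theorem sum_copTauW_primeSq_eq (n N : ℕ) :
    ∑ k ∈ Icc 1 N, copTauW n k * ∑ p ∈ k.primeFactors, Real.log p ^ 2 =
      ∑ m ∈ Icc 1 N, hloc n m *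
        (2 * ∑ d ∈ Icc 1 (N / m), ∑ e ∈ Icc 1 (N / m / d),
            (ArithmeticFunction.moebius d : ℝ) / d * (∑ p ∈ d.primeFactors, Real.log p ^ 2) *
              ((ArithmeticFunction.moebius e : ℝ) / e) +
          (m.factorization.sum fun p k ↦ (k : ℝ) * Real.log p ^ 2) *
            ∑ d ∈ Ioc 0 (N / m), ∑ e ∈ Ioc 0 (N / m / d),
              (ArithmeticFunction.moebius d : ℝ) / d * ((ArithmeticFunction.moebius e : ℝ) / e)) := by
  classical
  -- abbreviation for `P̃₂`
  set Pt : ℕ → ℝ := fun m ↦ m.factorization.sum fun p k ↦ (k : ℝ) * Real.log p ^ 2 with hPt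
  have hPt_mul : ∀ a b : ℕ, a ≠ 0 → b ≠ 0 → Pt (a * b) = Pt a + Pt b := fun a b ha hb ↦
    factorization_sum_logSq_mul ha hb
  -- Step A: `a_n(k)P₂(k) = a_n(k)P̃₂(k)`
  have hA : ∀ k : ℕ, copTauW n k * ∑ p ∈ k.primeFactors, Real.log p ^ 2 = copTauW n k * Pt k := by
    intro k
    by_cases hk : Squarefree k
    · rw [hPt]; dsimp only; rw [factorization_sum_logSq_of_squarefree hk]
    · have : copTauW n k = 0 := by
        rw [copTauW_apply]
        split_ifs
        · rw [W_eq_zero_of_not_squarefree hk, mul_zero]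
        · rfl
      rw [this, zero_mul, zero_mul]
  -- `G(d)·P̃₂(d) = μ(d)/d·P₂(d)`
  have hG : ∀ d : ℕ, G d * Pt d = (ArithmeticFunction.moebius d : ℝ) / d * ∑ p ∈ d.primeFactors, Real.log p ^ 2 := by
    intro d
    rw [G_apply']
    by_cases hd : Squarefree d
    · rw [hPt]; dsimp only; rw [factorization_sum_logSq_of_squarefree hd, div_eq_mul_inv]
    · rw [ArithmeticFunction.moebius_eq_zero_of_not_squarefree hd]; simp
  rw [Finset.sum_congr rfl fun k _ ↦ hA k]
  -- Step B: `a_n = h_n ∗ (G ∗ G)` and the first rearrangement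
  rw [copTauW_eq_G_mul_G_mul_hloc, mul_comm (G * G) (hloc n), Icc_one_eq_Ioc_zero]
  have h1 : ∀ k ∈ Ioc 0 N, (hloc n * (G * G)) k * Pt k =
      ∑ x ∈ k.divisorsAntidiagonal, (hloc n x.1 * (G * G) x.2 * Pt x.1 + hloc n x.1 * ((G * G) x.2 * Pt x.2)) := by
    intro k hk
    rw [ArithmeticFunction.mul_apply, Finset.sum_mul]
    refine Finset.sum_congr rfl fun x hx ↦ ?_
    have hx' := Nat.mem_divisorsAntidiagonal.1 hx
    have h0 : x.1 ≠ 0 ∧ x.2 ≠ 0 :=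
      ⟨fun h ↦ hx'.2 (by rw [← hx'.1, h, zero_mul]), fun h ↦ hx'.2 (by rw [← hx'.1, h, mul_zero])⟩
    rw [← hx'.1, hPt_mul _ _ h0.1 h0.2]
    ring
  rw [Finset.sum_congr rfl h1,
    sum_Ioc_sum_divisorsAntidiagonal_eq (fun a b ↦ hloc n a * (G * G) b * Pt a + hloc n a * ((G * G) b * Pt b)) N,
    ← Icc_one_eq_Ioc_zero]
  refine Finset.sum_congr rfl fun m hm ↦ ?_
  rw [Finset.sum_add_distrib]
  -- the two inner sums over `j ≤ N/m`
  have hMM : ∑ j ∈ Ioc 0 (N / m), hloc n m * (G * G) j * Pt m =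
      hloc n m * (Pt m * ∑ d ∈ Ioc 0 (N / m), ∑ e ∈ Ioc 0 (N / m / d),
        (ArithmeticFunction.moebius d : ℝ) / d * ((ArithmeticFunction.moebius e : ℝ) / e)) := by
    have h := Summit.Parity.GeneralizedHardyLittlewood.Theorems.BeyondDiagonalBeatsQuarter.Corner.sum_G_mul_G_eq_hyperbola
      ((N / m : ℕ) : ℝ)
    rw [Nat.floor_natCast, Icc_one_eq_Ioc_zero] at h
    rw [← h, Finset.mul_sum, Finset.mul_sum]
    refine Finset.sum_congr rfl fun j _ ↦ ?_
    ring
  have hN2 : ∑ j ∈ Ioc 0 (N / m), hloc n m * ((G * G) j * Pt j) =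
      hloc n m * (2 * ∑ d ∈ Icc 1 (N / m), ∑ e ∈ Icc 1 (N / m / d),
        (ArithmeticFunction.moebius d : ℝ) / d * (∑ p ∈ d.primeFactors, Real.log p ^ 2) *
          ((ArithmeticFunction.moebius e : ℝ) / e)) := by
    rw [← Finset.mul_sum]
    congr 1
    -- expand `(G∗G)(j)·P̃₂(j)` and rearrange
    have h2 : ∀ j ∈ Ioc 0 (N / m), (G * G) j * Pt j =
        ∑ x ∈ j.divisorsAntidiagonal, (G x.1 * Pt x.1 * G x.2 + G x.2 * Pt x.2 * G x.1) := by
      intro j hj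
      rw [ArithmeticFunction.mul_apply, Finset.sum_mul]
      refine Finset.sum_congr rfl fun x hx ↦ ?_
      have hx' := Nat.mem_divisorsAntidiagonal.1 hx
      have h0 : x.1 ≠ 0 ∧ x.2 ≠ 0 :=
        ⟨fun h ↦ hx'.2 (by rw [← hx'.1, h, zero_mul]), fun h ↦ hx'.2 (by rw [← hx'.1, h, mul_zero])⟩
      rw [← hx'.1, hPt_mul _ _ h0.1 h0.2]
      ring
    rw [Finset.sum_congr rfl h2,
      sum_Ioc_sum_divisorsAntidiagonal_eq (fun a b ↦ G a * Pt a * G b + G b * Pt b * G a) (N / m),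
      Finset.sum_congr rfl fun d _ ↦ Finset.sum_add_distrib, Finset.sum_add_distrib]
    -- the second double sum equals the first by the symmetry of `{de ≤ M}`
    have hsymm : ∑ d ∈ Ioc 0 (N / m), ∑ e ∈ Ioc 0 (N / m / d), G e * Pt e * G d =
        ∑ d ∈ Ioc 0 (N / m), ∑ e ∈ Ioc 0 (N / m / d), G d * Pt d * G e := by
      refine Finset.sum_comm' fun d e ↦ ?_
      simp only [Finset.mem_Ioc]
      constructor
      · rintro ⟨⟨hd0, hdM⟩, he0, heM⟩
        have hde : e * d ≤ N / m := (Nat.le_div_iff_mul_le hd0).1 heM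
        refine ⟨⟨hd0, ?_⟩, he0, heM.trans (Nat.div_le_self _ _)⟩
        exact (Nat.le_div_iff_mul_le he0).2 (by rwa [mul_comm] at hde)
      · rintro ⟨⟨hd0, hdMe⟩, he0, heM⟩
        have hde : d * e ≤ N / m := (Nat.le_div_iff_mul_le he0).1 hdMe
        refine ⟨⟨hd0, hdMe.trans (Nat.div_le_self _ _)⟩, he0, ?_⟩
        exact (Nat.le_div_iff_mul_le hd0).2 (by rwa [mul_comm] at hde)
    rw [hsymm, ← two_mul, ← Icc_one_eq_Ioc_zero]
    congr 1
    refine Finset.sum_congr rfl fun d _ ↦ ?_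
    rw [← Icc_one_eq_Ioc_zero]
    refine Finset.sum_congr rfl fun e _ ↦ ?_
    rw [hG d, G_apply']
    ring
  rw [hMM, hN2]
  ring

end Summit.Parity.GeneralizedHardyLittlewood.Theorems.MomentsBeyondDiagonal.DiagCorner

end
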